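import Literature.Analysis.PDE.NeumannHalfBallRegularity
import Literature.Analysis.FunctionSpaces.SobolevDomainLinearMaps
import Literature.Analysis.FluidPDE.HelmholtzAnnihilator
import HarnessLib

/-!
# Normal `H²`-regularity at a flat boundary portion for weak solutions of the Neumann problem:
# the normal derivative from the equation, and `u ∈ W^{2,2}` on smaller half-balls

Topic `Analysis/PDE`. Theorem file (no definitions, no named facts; everything proved), the second
half of Evans, *PDE*, §6.3.2, Theorem 4 (boundary `H²`-regularity) in the Neumann setting of
`NeumannHalfBallRegularity.lean` (`IsWeakNeumannHalfBall`), on the discharge path of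
`Literature.Geometry.Riemannian.sharpLogSobolevAVR_four`.

## Statement

Let `u` be a weak solution of the Neumann problem on the half-ball `U_R = B(z,R) ∩ {⟪y - z, ν⟫ < 0}`
(`IsWeakNeumannHalfBall μ ν z R A F G u ∇u`: `∫ ⟪A∇u, ∇ζ⟫ = ∫ (Fζ + ⟪G, ∇ζ⟫)` for
`ζ ∈ C_c^∞(B(z,R))`) with smooth coefficients `A`, uniformly elliptic on the whole space
(`λ‖ξ‖² ≤ ⟪A(y)ξ, ξ⟫`), `F ∈ L²(U_R)`, `G ∈ W^{1,2}(U_R; H)`, `ν ≠ 0`. Then for `0 < r < R`: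

* `IsWeakNeumannHalfBall.exists_hasWeakFDerivOn_grad_of_tangential` (the normal step at EVERY
  Sobolev order `m`, for the induction of `NeumannHalfBallHigher.lean`): if on `U_r` (`r ≤ R`) the
  gradient `∇u`, the source `F` and the components of the weak derivative of `G` lie in `W^{m,2}`,
  and `∇u` has, along every tangential direction, a weak derivative in `W^{m,2}(U_r; H)`, then `∇u`
  has a weak Fréchet derivative on `U_r` all of whose components lie in `W^{m,2}(U_r; H)`;
* `IsWeakNeumannHalfBall.memSobolevDomain_grad`: `∇u ∈ W^{1,2}(U_r; H)` (`m = 0`, the tangential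
  data being supplied by `exists_hasWeakDerivAlong_tangential`, `r < R`);
* `IsWeakNeumannHalfBall.memSobolevDomain_two`: `u ∈ W^{2,2}(U_r)`.

## Proof (Evans §6.3.2, Theorem 4, end of proof; §6.3.1, Theorem 1, step 4)

The tangential derivatives of `∇u` lie in `L²(U_r)` (`exists_hasWeakDerivAlong_tangential`). For the
normal direction `n = ν/‖ν‖`: testing the weak formulation with `φ ∈ C_c^∞(U_r)` and splitting
`∇φ` into its normal and tangential parts shows that the conormal flux `q = ⟪n, A∇u - G⟫` has the
weak normal derivative `-(F + Σᵢ ∂_{τᵢ} ⟪bᵢ, A∇u - G⟫) ∈ L²` ("solving the equation for `u_{x_n x_n}`",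
Evans (6.3.21)); weak mixed derivatives commute (`hasWeakDerivAlong_inner_swap`, Schwarz for the
test functions), so the tangential components of `∇u` have normal derivatives; subtracting them from
`⟪n, A∇u⟫` and dividing by `a_{nn} = ⟪n, A n⟫ ≥ λ` gives the normal derivative of `⟪n, ∇u⟫`;
recombining along an orthonormal basis (`HasWeakDerivAlong.hasWeakFDerivOn_of_basis`) yields
`∇u ∈ W^{1,2}(U_r; H)` and `u ∈ W^{2,2}(U_r)`.

## References

* L. C. Evans, *Partial Differential Equations*, 2nd ed. (2010), §6.3.2 Theorem 4, §6.3.1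
  Theorem 1 (step 4, the normal derivative from the equation). [Evans2010]
* M. E. Taylor, *Partial Differential Equations I*, 2nd ed. (2011), Ch. 5 §7, Proposition 7.2 and
  (7.31)–(7.34). [TaylorPDEI2011]
-/

noncomputable section

open MeasureTheory TopologicalSpace Set Function Filter Topology InnerProductSpace Metric
open scoped RealInnerProductSpace ENNReal NNReal ContDiff

namespace Literature.Analysis.PDE

open Literature.Analysis.FunctionSpaces Literature.Analysis.FluidPDE SobolevApprox

variable {H : Type*} [NormedAddCommGroup H] [InnerProductSpace ℝ H] [FiniteDimensional ℝ H]
  [MeasurableSpace H] [BorelSpace H]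

/-! ### Weak mixed derivatives commute -/

omit [FiniteDimensional ℝ H] [BorelSpace H] in
/-- **Weak mixed derivatives commute** (Schwarz for the test functions): if `⟪∇u, ·⟫` is the weak
derivative of `u` on `Ω` and the component `⟪b, ∇u⟫` has the weak derivative `h` along the constant
field `a`, then `⟪a, ∇u⟫` has the weak derivative `h` along `b`. [folklore] -/
theorem hasWeakDerivAlong_inner_swap {Ω : Opens H} {μ : Measure H} {u : H → ℝ} {gu : H → H}
    (hu : HasWeakFDerivOn Ω μ u (fun y => innerSL ℝ (gu y)))
    (hgu : LocallyIntegrableOn gu (Ω : Set H) μ) {a b : H} {h : H → ℝ}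
    (hh : HasWeakDerivAlong Ω μ (fun _ => a) (fun y => ⟪b, gu y⟫) h) :
    HasWeakDerivAlong Ω μ (fun _ => b) (fun y => ⟪a, gu y⟫) h where
  locallyIntegrableOn := by
    have e : (fun y => ⟪a, gu y⟫) = fun y => innerSL ℝ a (gu y) := by
      funext y; rw [innerSL_apply_apply]
    rw [e]
    exact (innerSL ℝ a).locallyIntegrableOn_comp hgu
  locallyIntegrableOn_deriv := hh.locallyIntegrableOn_deriv
  integral_eq φ hφ := by
    have hφ2 : ContDiff ℝ 2 φ := hφ.contDiff.of_le (by norm_cast)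
    have htest : ∀ c : H, IsTestFunctionOn Ω (fun x => fderiv ℝ φ x c) := fun c =>
      ⟨(hφ.contDiff.fderiv_right (m := ∞) (by norm_cast)).clm_apply contDiff_const,
        hφ.hasCompactSupport.fderiv_apply (𝕜 := ℝ) c,
        (tsupport_fderiv_apply_subset ℝ c).trans hφ.tsupport_subset⟩
    have h1 := hu.integral_fderiv_smul_eq (fun x => fderiv ℝ φ x b) a (htest b)
    have h2 := hu.integral_fderiv_smul_eq (fun x => fderiv ℝ φ x a) b (htest a)
    have h3 := hh.integral_eq φ hφ
    simp only [innerSL_apply_apply] at h1 h2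
    simp only [HasWeakDerivAlong.divergence_const_field, zero_mul, add_zero] at h3 ⊢
    have hsymm : ∀ x, fderiv ℝ (fun x => fderiv ℝ φ x b) x a =
        fderiv ℝ (fun x => fderiv ℝ φ x a) x b := fun x => fderiv_fderiv_apply_comm hφ2 x a b
    calc ∫ x in (Ω : Set H), (fderiv ℝ φ x b) • ⟪a, gu x⟫ ∂μ
        = -∫ x in (Ω : Set H), (fderiv ℝ (fun x => fderiv ℝ φ x b) x a) • u x ∂μ := by
          rw [h1, neg_neg]
          refine integral_congr_ae (Eventually.of_forall fun x => ?_)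
          simp only [real_inner_comm]
      _ = -∫ x in (Ω : Set H), (fderiv ℝ (fun x => fderiv ℝ φ x a) x b) • u x ∂μ := by
          simp_rw [hsymm]
      _ = ∫ x in (Ω : Set H), (fderiv ℝ φ x a) • ⟪b, gu x⟫ ∂μ := by
          rw [h2, neg_neg]
          refine integral_congr_ae (Eventually.of_forall fun x => ?_)
          simp only [real_inner_comm]
      _ = -∫ x in (Ω : Set H), φ x • h x ∂μ := h3

/-! ### Pointwise expansions along an orthonormal basis -/

section Expansions

omit [FiniteDimensional ℝ H] [MeasurableSpace H] [BorelSpace H]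

/-- `⟪c, A g⟫ = Σⱼ ⟪c, A bⱼ⟫ ⟪bⱼ, g⟫`. [folklore] -/
theorem inner_clm_apply_expand {ι : Type*} [Fintype ι] (b : OrthonormalBasis ι ℝ H)
    (A : H →L[ℝ] H) (c g : H) : ⟪c, A g⟫ = ∑ j, ⟪c, A (b j)⟫ * ⟪b j, g⟫ := by
  conv_lhs => rw [← b.sum_repr' g]
  rw [map_sum, inner_sum]
  refine Finset.sum_congr rfl fun j _ => ?_
  rw [map_smul, real_inner_smul_right, mul_comm]

/-- `Dφ(y) V = Σᵢ ⟪bᵢ, V⟫ Dφ(y) bᵢ`. [folklore] -/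
theorem clm_apply_expand {ι : Type*} [Fintype ι] (b : OrthonormalBasis ι ℝ H) (L : H →L[ℝ] ℝ)
    (V : H) : L V = ∑ i, ⟪b i, V⟫ * L (b i) := by
  conv_lhs => rw [← b.sum_repr' V]
  rw [map_sum]
  refine Finset.sum_congr rfl fun i _ => ?_
  rw [map_smul, smul_eq_mul]

end Expansions

/-! ### The normal derivative from the equation -/

namespace IsWeakNeumannHalfBall

variable {μ : Measure H} {ν z : H} {R : ℝ} {A : H → H →L[ℝ] H} {F : H → ℝ} {G : H → H}
  {u : H → ℝ} {gu : H → H}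

omit [InnerProductSpace ℝ H] [FiniteDimensional ℝ H] in
/-- A continuous scalar function bounded by `M` on `S` times an `L²(S)` scalar function is in
`L²(S)`. [folklore] -/
theorem memLp_continuous_mul {S : Set H} (hSm : MeasurableSet S) {ψ : H → ℝ} (hψ : Continuous ψ)
    {M : ℝ} (hM : ∀ y ∈ S, ‖ψ y‖ ≤ M) {f : H → ℝ} (hf : MemLp f 2 (μ.restrict S)) :
    MemLp (fun y => ψ y * f y) 2 (μ.restrict S) := by
  refine hf.of_le_mul (c := M) (hψ.aestronglyMeasurable.mul hf.1) ?_
  rw [ae_restrict_iff' hSm]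
  exact Eventually.of_forall fun y hy => by
    rw [norm_mul]; exact mul_le_mul_of_nonneg_right (hM y hy) (norm_nonneg _)

omit [FiniteDimensional ℝ H] [BorelSpace H] in
/-- A component `⟪c, g⟫` of an `L²` field is in `L²`. [folklore] -/
theorem memLp_const_inner {μ' : Measure H} {g : H → H} (hg : MemLp g 2 μ') (c : H) :
    MemLp (fun y => ⟪c, g y⟫) 2 μ' :=
  hg.of_le_mul (c := ‖c‖) (aestronglyMeasurable_const.inner hg.1)
    (Eventually.of_forall fun y => norm_inner_le_norm c (g y))

set_option maxHeartbeats 3200000 in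
/-- **The normal derivative from the equation, at every Sobolev order** (Evans, *PDE*, §6.3.2,
Theorem 4 and Theorem 5 (induction step) with §6.3.1, Theorem 1, step 4; Taylor, *PDE I*, Ch. 5 §7,
Prop. 7.2 and (7.31)–(7.34)): for smooth, globally uniformly elliptic coefficients and `ν ≠ 0`, on
`U_r` (`r ≤ R`): if `∇u`, `F` and the components of a weak derivative `DG` of `G` lie in
`W^{m,2}(U_r)`, and along every tangential direction `τ` the gradient `∇u` has a weak derivative in
`W^{m,2}(U_r; H)`, then `∇u` has a weak Fréchet derivative on `U_r` with all components in
`W^{m,2}(U_r; H)` — the conormal flux `⟪n, A∇u - G⟫` has the weak normal derivative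
`-(F + Σᵢ ∂_{τᵢ}⟪bᵢ, A∇u - G⟫)`, weak mixed derivatives commute, and `a_{nn} = ⟪n, A n⟫ ≥ λ` is
inverted. [cite: Evans2010, §6.3.2 Theorems 4–5] -/
theorem exists_hasWeakFDerivOn_grad_of_tangential [μ.IsAddHaarMeasure]
    (hsol : IsWeakNeumannHalfBall μ ν z R A F G u gu) (hA : ContDiff ℝ ∞ A) {lam : ℝ}
    (hlam : 0 < lam) (hell : ∀ (y : H) (ξ : H), lam * ‖ξ‖ ^ 2 ≤ ⟪A y ξ, ξ⟫) (hν : ν ≠ 0) {r : ℝ}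
    (hrR : r ≤ R) {k : ℕ}
    (htan : ∀ τ : H, ⟪τ, ν⟫ = 0 → ∃ gτ : H → H, MemSobolevDomain k 2 (halfBall ν z r) μ gτ ∧
      HasWeakDerivAlong (halfBall ν z r) μ (fun _ => τ) gu gτ)
    (hgum : MemSobolevDomain k 2 (halfBall ν z r) μ gu)
    (hFm : MemSobolevDomain k 2 (halfBall ν z r) μ F)
    (hDGex : ∃ DG : H → H →L[ℝ] H, HasWeakFDerivOn (halfBall ν z R) μ G DG ∧
      ∀ v : H, MemSobolevDomain k 2 (halfBall ν z r) μ (fun y => DG y v)) :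
    ∃ Dgu : H → H →L[ℝ] H, HasWeakFDerivOn (halfBall ν z r) μ gu Dgu ∧
      ∀ v : H, MemSobolevDomain k 2 (halfBall ν z r) μ (fun y => Dgu y v) := by
  -- the sets
  set U : Opens H := halfBall ν z R with hU
  set U' : Opens H := halfBall ν z r with hU'
  have hU'U : U' ≤ U := halfBall_mono hrR
  have hbU' : Bornology.IsBounded (U' : Set H) := isBounded_halfBall
  have hUm : MeasurableSet (U : Set H) := U.isOpen.measurableSet
  have hU'm : MeasurableSet (U' : Set H) := U'.isOpen.measurableSet
  have hU'ball : (U' : Set H) ⊆ closedBall z r := halfBall_subset_ball.trans ball_subset_closedBall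
  haveI : IsFiniteMeasure (μ.restrict (U' : Set H)) :=
    ⟨by rw [Measure.restrict_apply_univ]; exact measure_halfBall_lt_top μ⟩
  haveI : IsFiniteMeasure (μ.restrict (U : Set H)) :=
    ⟨by rw [Measure.restrict_apply_univ]; exact measure_halfBall_lt_top μ⟩
  have hA1 : ContDiff ℝ 1 A := hA.of_le (by norm_cast)
  -- the normal, the basis, the tangential parts of the basis vectors
  set n : H := ‖ν‖⁻¹ • ν with hn
  have hνn : ‖ν‖ ≠ 0 := norm_ne_zero_iff.2 hν
  have hn1 : ‖n‖ = 1 := by rw [hn, norm_smul, norm_inv, norm_norm, inv_mul_cancel₀ hνn]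
  set b := stdOrthonormalBasis ℝ H with hb
  have hb1 : ∀ i, ‖b i‖ = 1 := fun i => b.orthonormal.1 i
  set c : Fin (Module.finrank ℝ H) → ℝ := fun i => ⟪n, b i⟫ with hc
  set τ : Fin (Module.finrank ℝ H) → H := fun i => b i - c i • n with hτ
  have hbτ : ∀ i, b i = c i • n + τ i := fun i => by simp only [hτ]; abel
  have hnν : ⟪n, ν⟫ = ‖ν‖ := by
    rw [hn, real_inner_smul_left, real_inner_self_eq_norm_sq, pow_two, inv_mul_cancel_left₀ hνn]
  have hτν : ∀ i, ⟪τ i, ν⟫ = 0 := fun i => by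
    simp only [hτ, hc, inner_sub_left, real_inner_smul_left, hnν]
    rw [hn, real_inner_smul_left, real_inner_comm (b i) ν]
    field_simp
    ring
  have hX1 : ∀ w : H, ContDiff ℝ 1 (fun _ : H => w) := fun w => contDiff_const
  have hXi : ∀ w : H, ContDiff ℝ ∞ (fun _ : H => w) := fun w => contDiff_const
  obtain ⟨i₀⟩ : Nonempty (Fin (Module.finrank ℝ H)) :=
    ⟨⟨0, Module.finrank_pos_iff_exists_ne_zero.2 ⟨ν, hν⟩⟩⟩
  -- data
  have hguU : MemLp gu 2 (μ.restrict (U : Set H)) := hsol.memLp_grad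
  have hguU' : MemLp gu 2 (μ.restrict (U' : Set H)) := hgum.memLp
  have hguI : IntegrableOn gu (U' : Set H) μ := hguU'.integrable (by norm_num)
  have hguloc : LocallyIntegrableOn gu (U' : Set H) μ := hguI.locallyIntegrableOn
  have huU' : HasWeakFDerivOn U' μ u (fun y => innerSL ℝ (gu y)) :=
    HasWeakFDerivOn.mono_set_holds hsol.hasWeakFDerivOn hU'U
  have hGm : MemLp G 2 (μ.restrict (U : Set H)) := hsol.memSobolev_flux.memLp
  obtain ⟨DG, hDG, hDGk⟩ := hDGex
  have hGU' : MemLp G 2 (μ.restrict (U' : Set H)) := hGm.mono_measure (Measure.restrict_mono_set μ hU'U)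
  have hDGw : ∀ w : H, HasWeakDerivAlong U' μ (fun _ => w) G (fun y => DG y w) := fun w =>
    ((hDG.hasWeakDerivAlong (hXi w)).mono hU'U)
  have hDGm : ∀ w : H, MemLp (fun y => DG y w) 2 (μ.restrict (U' : Set H)) := fun w =>
    (hDGk w).memLp
  have hFU' : MemLp F 2 (μ.restrict (U' : Set H)) := hFm.memLp
  -- STEP 1: tangential derivatives of the gradient (hypothesis `htan`)
  choose gτ hgτk hgτ using fun i => htan (τ i) (hτν i)
  have hgτm : ∀ i, MemLp (gτ i) 2 (μ.restrict (U' : Set H)) := fun i => (hgτk i).memLp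
  -- scalar components and their tangential derivatives
  have hs : ∀ i (w : H), HasWeakDerivAlong U' μ (fun _ => τ i) (fun y => ⟪w, gu y⟫)
      (fun y => ⟪w, gτ i y⟫) := fun i w => by
    have := (hgτ i).clm_apply (hX1 _) (innerSL ℝ w)
    simpa only [innerSL_apply_apply] using this
  -- STEP 2: the coefficient functions
  have haij : ∀ w w' : H, ContDiff ℝ ∞ fun y => ⟪w, A y w'⟫ := fun w w' =>
    contDiff_const.inner ℝ (hA.clm_apply contDiff_const)
  have hdaijc : ∀ w w' X : H, ContDiff ℝ ∞ fun y => fderiv ℝ (fun y => ⟪w, A y w'⟫) y X :=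
    fun w w' X => ((haij w w').fderiv_right (m := ∞) (by norm_cast)).clm_apply contDiff_const
  obtain ⟨MA, hMA0, hMA⟩ := exists_bound_coeff hA.continuous z r
  obtain ⟨MA', hMA'0, hMA'⟩ := exists_bound_coeff (hA.continuous_fderiv (by simp)) z r
  have haij_bd : ∀ (w w' : H), ∀ y ∈ (U' : Set H), ‖⟪w, A y w'⟫‖ ≤ ‖w‖ * MA * ‖w'‖ :=
    fun w w' y hy => by
      calc ‖⟪w, A y w'⟫‖ ≤ ‖w‖ * ‖A y w'‖ := norm_inner_le_norm _ _
        _ ≤ ‖w‖ * (MA * ‖w'‖) := by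
            gcongr; exact ((A y).le_opNorm w').trans (mul_le_mul_of_nonneg_right (hMA y (hU'ball hy)) (norm_nonneg _))
        _ = ‖w‖ * MA * ‖w'‖ := by ring
  have hdaij : ∀ (w w' X : H) (y : H), fderiv ℝ (fun y => ⟪w, A y w'⟫) y X = ⟪w, fderiv ℝ A y X w'⟫ :=
    fun w w' X y => by
      have hAd : DifferentiableAt ℝ A y := (hA.differentiable (by simp)) y
      rw [fderiv_inner_apply ℝ (differentiableAt_const w) (hAd.clm_apply (differentiableAt_const w')),
        fderiv_fun_const, Pi.zero_apply, zero_apply, inner_zero_left, add_zero,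
        fderiv_clm_apply hAd (differentiableAt_const w')]
      simp
  have hdaij_bd : ∀ (w w' X : H), ∀ y ∈ (U' : Set H),
      ‖fderiv ℝ (fun y => ⟪w, A y w'⟫) y X‖ ≤ ‖w‖ * MA' * ‖X‖ * ‖w'‖ := fun w w' X y hy => by
    rw [hdaij]
    calc ‖⟪w, fderiv ℝ A y X w'⟫‖ ≤ ‖w‖ * ‖fderiv ℝ A y X w'‖ := norm_inner_le_norm _ _
      _ ≤ ‖w‖ * (MA' * ‖X‖ * ‖w'‖) := by
          gcongr
          calc ‖fderiv ℝ A y X w'‖ ≤ ‖fderiv ℝ A y X‖ * ‖w'‖ := (fderiv ℝ A y X).le_opNorm w'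
            _ ≤ ‖fderiv ℝ A y‖ * ‖X‖ * ‖w'‖ := by gcongr; exact (fderiv ℝ A y).le_opNorm X
            _ ≤ MA' * ‖X‖ * ‖w'‖ := by gcongr; exact hMA' y (hU'ball hy)
      _ = ‖w‖ * MA' * ‖X‖ * ‖w'‖ := by ring
  -- STEP 3: the components `mᵢ = ⟪bᵢ, A∇u - G⟫` and their tangential derivatives
  set m : Fin (Module.finrank ℝ H) → H → ℝ := fun i y => ⟪b i, A y (gu y) - G y⟫ with hm
  set m' : Fin (Module.finrank ℝ H) → H → ℝ := fun i y =>
    (∑ j, (fderiv ℝ (fun y => ⟪b i, A y (b j)⟫) y (τ i) * ⟪b j, gu y⟫ +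
      ⟪b i, A y (b j)⟫ * ⟪b j, gτ i y⟫)) - ⟪b i, DG y (τ i)⟫ with hm'
  have hmw : ∀ i, HasWeakDerivAlong U' μ (fun _ => τ i) (m i) (m' i) := fun i => by
    have hterm : ∀ j, HasWeakDerivAlong U' μ (fun _ => τ i)
        (fun y => ⟪b i, A y (b j)⟫ • ⟪b j, gu y⟫)
        (fun y => (fderiv ℝ (fun y => ⟪b i, A y (b j)⟫) y (τ i)) • ⟪b j, gu y⟫ +
          ⟪b i, A y (b j)⟫ • ⟪b j, gτ i y⟫) := fun j => (hs i (b j)).smul (hX1 _) (haij _ _)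
    have hsum := HasWeakDerivAlong.finset_sum (hX1 _) Finset.univ (fun j _ => hterm j)
    have hGi : HasWeakDerivAlong U' μ (fun _ => τ i) (fun y => ⟪b i, G y⟫)
        (fun y => ⟪b i, DG y (τ i)⟫) := by
      have := (hDGw (τ i)).clm_apply (hX1 _) (innerSL ℝ (b i))
      simpa only [innerSL_apply_apply] using this
    have hsub := hsum.sub (hX1 _) hGi
    refine (hsub.congr (Eventually.of_forall fun y => ?_)).congr_deriv (Eventually.of_forall fun y => ?_)
    · show (∑ j, ⟪b i, A y (b j)⟫ • ⟪b j, gu y⟫) - ⟪b i, G y⟫ = m i y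
      simp only [hm, inner_sub_right, smul_eq_mul, inner_clm_apply_expand b (A y) (b i) (gu y)]
    · show (∑ j, ((fderiv ℝ (fun y => ⟪b i, A y (b j)⟫) y (τ i)) • ⟪b j, gu y⟫ +
          ⟪b i, A y (b j)⟫ • ⟪b j, gτ i y⟫)) - ⟪b i, DG y (τ i)⟫ = m' i y
      simp only [hm', smul_eq_mul]
  have hmm : ∀ i, MemLp (m i) 2 (μ.restrict (U' : Set H)) := fun i => by
    have h1 : MemLp (fun y => A y (gu y) - G y) 2 (μ.restrict (U' : Set H)) :=
      (memLp_coeff_apply hU'm hA.continuous hMA0 (fun y hy => hMA y (hU'ball hy)) hguU').1.sub hGU'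
    exact memLp_const_inner h1 (b i)
  have hm'k : ∀ i, MemSobolevDomain k 2 U' μ (m' i) := fun i => by
    refine MemSobolevDomain.sub' (memSobolevDomain_finsetSum _ fun j _ =>
      MemSobolevDomain.add' ?_ ?_) ((hDGk (τ i)).const_inner (b i))
    · exact ((hgum.const_inner (b j)).smooth_mul hbU' (hdaijc _ _ _))
    · exact (((hgτk i).const_inner (b j)).smooth_mul hbU' (haij _ _))
  have hm'm : ∀ i, MemLp (m' i) 2 (μ.restrict (U' : Set H)) := fun i => (hm'k i).memLp
  -- STEP 4: the conormal flux `q = ⟪n, A∇u - G⟫` has a weak normal derivative, from the equation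
  set q : H → ℝ := fun y => ⟪n, A y (gu y) - G y⟫ with hq
  set q' : H → ℝ := fun y => -(F y + ∑ i, m' i y) with hq'
  have hqm : MemLp q 2 (μ.restrict (U' : Set H)) :=
    memLp_const_inner ((memLp_coeff_apply hU'm hA.continuous hMA0
      (fun y hy => hMA y (hU'ball hy)) hguU').1.sub hGU') n
  have hq'k : MemSobolevDomain k 2 U' μ q' :=
    memSobolevDomain_neg (hFm.add' (memSobolevDomain_finsetSum _ fun i _ => hm'k i))
  have hq'm : MemLp q' 2 (μ.restrict (U' : Set H)) := hq'k.memLp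
  have hLI : ∀ {f : H → ℝ}, MemLp f 2 (μ.restrict (U' : Set H)) →
      LocallyIntegrableOn f (U' : Set H) μ := fun {f} hf => by
    have hI : IntegrableOn f (U' : Set H) μ := hf.integrable (by norm_num)
    exact hI.locallyIntegrableOn
  have hqw : HasWeakDerivAlong U' μ (fun _ => n) q q' := by
    refine ⟨hLI hqm, hLI hq'm, fun φ hφ => ?_⟩
    simp only [HasWeakDerivAlong.divergence_const_field, zero_mul, add_zero]
    have hφd : Differentiable ℝ φ := hφ.contDiff.differentiable (by simp)
    -- the weak formulation with the interior test function `φ`, moved to `U'`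
    have hφs : tsupport φ ⊆ (U' : Set H) := hφ.tsupport_subset
    have hφ0 : ∀ y, y ∉ (U' : Set H) → φ y = 0 := fun y hy =>
      image_eq_zero_of_notMem_tsupport fun h' => hy (hφs h')
    have hDφ0 : ∀ y, y ∉ (U' : Set H) → fderiv ℝ φ y = 0 := fun y hy =>
      fderiv_of_notMem_tsupport ℝ fun h' => hy (hφs h')
    have hweak := hsol.weak_eq φ hφ.contDiff hφ.hasCompactSupport
      (hφs.trans ((halfBall_subset_ball).trans (ball_subset_ball hrR)))
    rw [setIntegral_eq_of_subset_of_forall_sdiff_eq_zero hUm hU'U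
        (fun y hy => by rw [hDφ0 y hy.2, zero_apply]),
      setIntegral_eq_of_subset_of_forall_sdiff_eq_zero hUm hU'U
        (fun y hy => by rw [hDφ0 y hy.2, hφ0 y hy.2, zero_apply, mul_zero, add_zero])]
      at hweak
    -- test-function factors
    set ψ : Fin (Module.finrank ℝ H) → H → ℝ := fun i y => fderiv ℝ φ y (b i) with hψ
    have hψt : ∀ w : H, IsTestFunctionOn U' (fun y => fderiv ℝ φ y w) := fun w =>
      ⟨(hφ.contDiff.fderiv_right (m := ∞) (by norm_cast)).clm_apply contDiff_const,
        hφ.hasCompactSupport.fderiv_apply (𝕜 := ℝ) w,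
        (tsupport_fderiv_apply_subset ℝ w).trans hφ.tsupport_subset⟩
    -- integrability of the pieces (test factor times `L²` function)
    have hint : ∀ {w : H} {f : H → ℝ}, MemLp f 2 (μ.restrict (U' : Set H)) →
        Integrable (fun y => fderiv ℝ φ y w * f y) (μ.restrict (U' : Set H)) := fun {w f} hf =>
      HasWeakDerivAlong.integrableOn_smul (hψt w) (hLI hf)
    have hintφ : ∀ {f : H → ℝ}, MemLp f 2 (μ.restrict (U' : Set H)) →
        Integrable (fun y => φ y * f y) (μ.restrict (U' : Set H)) := fun {f} hf =>
      HasWeakDerivAlong.integrableOn_smul hφ (hLI hf)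
    -- expand both sides of the weak formulation along the basis
    have hA_exp : ∀ y, fderiv ℝ φ y (A y (gu y)) = ∑ i, ψ i y * ⟪b i, A y (gu y)⟫ := fun y => by
      rw [clm_apply_expand b (fderiv ℝ φ y) (A y (gu y))]
      exact Finset.sum_congr rfl fun i _ => by simp only [hψ]; ring
    have hG_exp : ∀ y, fderiv ℝ φ y (G y) = ∑ i, ψ i y * ⟪b i, G y⟫ := fun y => by
      rw [clm_apply_expand b (fderiv ℝ φ y) (G y)]
      exact Finset.sum_congr rfl fun i _ => by simp only [hψ]; ring
    have hAi_m : ∀ i, MemLp (fun y => ⟪b i, A y (gu y)⟫) 2 (μ.restrict (U' : Set H)) := fun i =>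
      memLp_const_inner (memLp_coeff_apply hU'm hA.continuous hMA0
        (fun y hy => hMA y (hU'ball hy)) hguU').1 (b i)
    have hGi_m : ∀ i, MemLp (fun y => ⟪b i, G y⟫) 2 (μ.restrict (U' : Set H)) := fun i =>
      memLp_const_inner hGU' (b i)
    -- `Σᵢ ∫ ψᵢ mᵢ = ∫ F φ`
    have hsum_m : ∑ i, ∫ y in (U' : Set H), ψ i y * m i y ∂μ = ∫ y in (U' : Set H), F y * φ y ∂μ := by
      have hl : ∫ y in (U' : Set H), fderiv ℝ φ y (A y (gu y)) ∂μ =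
          ∑ i, ∫ y in (U' : Set H), ψ i y * ⟪b i, A y (gu y)⟫ ∂μ := by
        rw [← integral_finsetSum _ (fun i _ => hint (hAi_m i))]
        exact integral_congr_ae (Eventually.of_forall hA_exp)
      have hr' : ∫ y in (U' : Set H), (F y * φ y + fderiv ℝ φ y (G y)) ∂μ =
          (∫ y in (U' : Set H), F y * φ y ∂μ) + ∑ i, ∫ y in (U' : Set H), ψ i y * ⟪b i, G y⟫ ∂μ := by
        rw [integral_add ?_ ?_, ← integral_finsetSum _ (fun i _ => hint (hGi_m i))]
        · congr 1
          exact integral_congr_ae (Eventually.of_forall hG_exp)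
        · have := hintφ hFU'
          simpa only [mul_comm] using this
        · have e : (fun y => fderiv ℝ φ y (G y)) = fun y => ∑ i, ψ i y * ⟪b i, G y⟫ := funext hG_exp
          rw [e]
          exact integrable_finsetSum _ (fun i _ => hint (hGi_m i))
      rw [hl, hr'] at hweak
      have e : ∀ i, ∫ y in (U' : Set H), ψ i y * m i y ∂μ =
          (∫ y in (U' : Set H), ψ i y * ⟪b i, A y (gu y)⟫ ∂μ) -
            ∫ y in (U' : Set H), ψ i y * ⟪b i, G y⟫ ∂μ := fun i => by
        rw [← integral_sub (hint (hAi_m i)) (hint (hGi_m i))]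
        refine integral_congr_ae (Eventually.of_forall fun y => ?_)
        simp only [hm, hψ, inner_sub_right, mul_sub]
      simp_rw [e]
      rw [Finset.sum_sub_distrib]
      linarith
    -- split `ψᵢ = cᵢ ∂_n φ + ∂_{τᵢ} φ`
    have hψ_split : ∀ i y, ψ i y = c i * fderiv ℝ φ y n + fderiv ℝ φ y (τ i) := fun i y => by
      simp only [hψ]
      conv_lhs => rw [hbτ i]
      rw [map_add, map_smul, smul_eq_mul]
    have htan : ∀ i, ∫ y in (U' : Set H), fderiv ℝ φ y (τ i) * m i y ∂μ =
        -∫ y in (U' : Set H), φ y * m' i y ∂μ := fun i => by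
      have := (hmw i).integral_eq φ hφ
      simpa only [HasWeakDerivAlong.divergence_const_field, zero_mul, add_zero, smul_eq_mul] using this
    have hq_exp : ∀ y, ∑ i, c i * m i y = q y := fun y => by
      show ∑ i, ⟪n, b i⟫ * ⟪b i, A y (gu y) - G y⟫ = ⟪n, A y (gu y) - G y⟫
      exact b.sum_inner_mul_inner n _
    have hkey : ∫ y in (U' : Set H), fderiv ℝ φ y n * q y ∂μ =
        ∫ y in (U' : Set H), φ y * (F y + ∑ i, m' i y) ∂μ := by
      have e1 : ∀ i, ∫ y in (U' : Set H), ψ i y * m i y ∂μ =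
          c i * (∫ y in (U' : Set H), fderiv ℝ φ y n * m i y ∂μ) -
            ∫ y in (U' : Set H), φ y * m' i y ∂μ := fun i => by
        rw [sub_eq_add_neg, ← htan i, ← integral_const_mul,
          ← integral_add ((hint (hmm i)).const_mul _) (hint (hmm i))]
        refine integral_congr_ae (Eventually.of_forall fun y => ?_)
        show ψ i y * m i y = c i * (fderiv ℝ φ y n * m i y) + fderiv ℝ φ y (τ i) * m i y
        rw [hψ_split i y]; ring
      have e2 : ∑ i, c i * (∫ y in (U' : Set H), fderiv ℝ φ y n * m i y ∂μ) =
          ∫ y in (U' : Set H), fderiv ℝ φ y n * q y ∂μ := by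
        simp_rw [← integral_const_mul]
        rw [← integral_finsetSum _ (fun i _ => (hint (hmm i)).const_mul _)]
        refine integral_congr_ae (Eventually.of_forall fun y => ?_)
        show ∑ i, c i * (fderiv ℝ φ y n * m i y) = fderiv ℝ φ y n * q y
        rw [← hq_exp y, Finset.mul_sum]
        exact Finset.sum_congr rfl fun i _ => by ring
      have e3 : ∫ y in (U' : Set H), φ y * (F y + ∑ i, m' i y) ∂μ =
          (∫ y in (U' : Set H), F y * φ y ∂μ) + ∑ i, ∫ y in (U' : Set H), φ y * m' i y ∂μ := by
        rw [← integral_finsetSum _ (fun i _ => hintφ (hm'm i)), ← integral_add ?_ ?_]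
        · refine integral_congr_ae (Eventually.of_forall fun y => ?_)
          show φ y * (F y + ∑ i, m' i y) = F y * φ y + ∑ i, φ y * m' i y
          rw [mul_add, Finset.mul_sum]; ring
        · have := hintφ hFU'
          simpa only [mul_comm] using this
        · exact integrable_finsetSum _ (fun i _ => hintφ (hm'm i))
      rw [e3, ← hsum_m]
      simp_rw [e1]
      rw [Finset.sum_sub_distrib, e2]
      ring
    rw [show (∫ y in (U' : Set H), φ y • q' y ∂μ) = -∫ y in (U' : Set H), φ y * (F y + ∑ i, m' i y) ∂μ by
      rw [← integral_neg]
      refine integral_congr_ae (Eventually.of_forall fun y => ?_)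
      simp only [hq', smul_eq_mul, mul_neg]]
    rw [neg_neg, ← hkey]
    refine integral_congr_ae (Eventually.of_forall fun y => ?_)
    simp only [smul_eq_mul]
  -- STEP 5: `p₀ = ⟪n, A∇u⟫ = q + ⟪n, G⟫` has a weak normal derivative
  set p₀' : H → ℝ := fun y => q' y + ⟪n, DG y n⟫ with hp₀'
  have hp₀ : HasWeakDerivAlong U' μ (fun _ => n) (fun y => ⟪n, A y (gu y)⟫) p₀' := by
    have hGn : HasWeakDerivAlong U' μ (fun _ => n) (fun y => ⟪n, G y⟫) (fun y => ⟪n, DG y n⟫) := by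
      have := (hDGw n).clm_apply (hX1 _) (innerSL ℝ n)
      simpa only [innerSL_apply_apply] using this
    refine (hqw.add (hX1 _) hGn).congr (Eventually.of_forall fun y => ?_)
    show q y + ⟪n, G y⟫ = ⟪n, A y (gu y)⟫
    simp only [hq, inner_sub_right, sub_add_cancel]
  have hp₀'k : MemSobolevDomain k 2 U' μ p₀' := hq'k.add' ((hDGk n).const_inner n)
  -- STEP 6: tangential components have normal derivatives (weak mixed derivatives commute)
  have htn : ∀ i, HasWeakDerivAlong U' μ (fun _ => n) (fun y => ⟪τ i, gu y⟫)
      (fun y => ⟪n, gτ i y⟫) := fun i =>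
    hasWeakDerivAlong_inner_swap huU' hguloc (hs i n)
  -- STEP 7: the normal component `g₀ = ⟪n, ∇u⟫`
  set a₀₀ : H → ℝ := fun y => ⟪n, A y n⟫ with ha₀₀
  have ha₀₀c : ContDiff ℝ ∞ a₀₀ := haij n n
  have ha₀₀pos : ∀ y, lam ≤ a₀₀ y := fun y => by
    have := hell y n
    rw [hn1, one_pow, mul_one, real_inner_comm] at this
    exact this
  have ha₀₀ne : ∀ y, a₀₀ y ≠ 0 := fun y => (hlam.trans_le (ha₀₀pos y)).ne'
  set g₀ : H → ℝ := fun y => ⟪n, gu y⟫ with hg₀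
  -- `a₀₀ g₀ = p₀ - Σⱼ ⟪n, A bⱼ⟫ ⟪τⱼ, ∇u⟫`
  have hexp : ∀ y, a₀₀ y * g₀ y = ⟪n, A y (gu y)⟫ - ∑ j, ⟪n, A y (b j)⟫ * ⟪τ j, gu y⟫ := fun y => by
    have h1 : ⟪n, A y (gu y)⟫ = ∑ j, ⟪n, A y (b j)⟫ * ⟪b j, gu y⟫ :=
      inner_clm_apply_expand b (A y) n (gu y)
    have h2 : ∀ j, ⟪b j, gu y⟫ = c j * g₀ y + ⟪τ j, gu y⟫ := fun j => by
      show ⟪b j, gu y⟫ = c j * ⟪n, gu y⟫ + ⟪τ j, gu y⟫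
      conv_lhs => rw [hbτ j]
      rw [inner_add_left, real_inner_smul_left]
    have h3 : ∑ j, ⟪n, A y (b j)⟫ * c j = a₀₀ y := by
      show ∑ j, ⟪n, A y (b j)⟫ * c j = ⟪n, A y n⟫
      have e : A y n = ∑ j, c j • A y (b j) := by
        conv_lhs => rw [← b.sum_repr' n]
        rw [map_sum]
        refine Finset.sum_congr rfl fun j _ => ?_
        rw [map_smul]
        simp only [hc, real_inner_comm]
      rw [e, inner_sum]
      refine Finset.sum_congr rfl fun j _ => ?_
      rw [real_inner_smul_right, mul_comm]
    rw [h1, ← h3, Finset.sum_mul]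
    simp_rw [h2, mul_add, Finset.sum_add_distrib, mul_assoc]
    ring
  -- the remainder and its normal derivative
  set R₀' : H → ℝ := fun y => p₀' y - ∑ j, ((fderiv ℝ (fun y => ⟪n, A y (b j)⟫) y n) * ⟪τ j, gu y⟫ +
    ⟪n, A y (b j)⟫ * ⟪n, gτ j y⟫) with hR₀'
  have hR₀ : HasWeakDerivAlong U' μ (fun _ => n) (fun y => a₀₀ y * g₀ y) R₀' := by
    have hterm : ∀ j, HasWeakDerivAlong U' μ (fun _ => n) (fun y => ⟪n, A y (b j)⟫ • ⟪τ j, gu y⟫)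
        (fun y => (fderiv ℝ (fun y => ⟪n, A y (b j)⟫) y n) • ⟪τ j, gu y⟫ +
          ⟪n, A y (b j)⟫ • ⟪n, gτ j y⟫) := fun j => (htn j).smul (hX1 _) (haij _ _)
    have hsum := HasWeakDerivAlong.finset_sum (hX1 _) Finset.univ (fun j _ => hterm j)
    have hsub := hp₀.sub (hX1 _) hsum
    refine (hsub.congr (Eventually.of_forall fun y => ?_)).congr_deriv (Eventually.of_forall fun y => ?_)
    · show ⟪n, A y (gu y)⟫ - ∑ j, ⟪n, A y (b j)⟫ • ⟪τ j, gu y⟫ = a₀₀ y * g₀ y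
      rw [hexp y]; simp only [smul_eq_mul]
    · show p₀' y - ∑ j, ((fderiv ℝ (fun y => ⟪n, A y (b j)⟫) y n) • ⟪τ j, gu y⟫ +
          ⟪n, A y (b j)⟫ • ⟪n, gτ j y⟫) = R₀' y
      simp only [hR₀', smul_eq_mul]
  have hR₀'k : MemSobolevDomain k 2 U' μ R₀' := by
    refine hp₀'k.sub' (memSobolevDomain_finsetSum _ fun j _ => MemSobolevDomain.add' ?_ ?_)
    · exact (hgum.const_inner (τ j)).smooth_mul hbU' (hdaijc _ _ _)
    · exact ((hgτk j).const_inner n).smooth_mul hbU' (haij _ _)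
  -- divide by `a₀₀ ≥ λ > 0`
  set ψ₀ : H → ℝ := fun y => (a₀₀ y)⁻¹ with hψ₀
  have hψ₀c : ContDiff ℝ ∞ ψ₀ := ha₀₀c.inv ha₀₀ne
  set g₀' : H → ℝ := fun y => (fderiv ℝ ψ₀ y n) * (a₀₀ y * g₀ y) + ψ₀ y * R₀' y with hg₀'
  have hg₀w : HasWeakDerivAlong U' μ (fun _ => n) g₀ g₀' := by
    have h := hR₀.smul (hX1 _) hψ₀c
    refine (h.congr (Eventually.of_forall fun y => ?_)).congr_deriv (Eventually.of_forall fun y => ?_)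
    · show ψ₀ y • (a₀₀ y * g₀ y) = g₀ y
      simp only [hψ₀, smul_eq_mul]
      rw [← mul_assoc, inv_mul_cancel₀ (ha₀₀ne y), one_mul]
    · show (fderiv ℝ ψ₀ y n) • (a₀₀ y * g₀ y) + ψ₀ y • R₀' y = g₀' y
      simp only [hg₀', smul_eq_mul]
  have hag₀k : MemSobolevDomain k 2 U' μ (fun y => a₀₀ y * g₀ y) :=
    (hgum.const_inner n).smooth_mul hbU' ha₀₀c
  have hg₀'k : MemSobolevDomain k 2 U' μ g₀' := by
    refine MemSobolevDomain.add' ?_ ?_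
    · exact hag₀k.smooth_mul hbU'
        ((hψ₀c.fderiv_right (m := ∞) (by norm_cast)).clm_apply contDiff_const)
    · exact hR₀'k.smooth_mul hbU' hψ₀c
  -- STEP 8: every component, hence the gradient, has a normal derivative
  have hbn : ∀ i, HasWeakDerivAlong U' μ (fun _ => n) (fun y => ⟪b i, gu y⟫)
      (fun y => c i * g₀' y + ⟪n, gτ i y⟫) := fun i => by
    have h := (hg₀w.const_smul (c i)).add (hX1 _) (htn i)
    refine (h.congr (Eventually.of_forall fun y => ?_)).congr_deriv (Eventually.of_forall fun y => ?_)
    · show c i • g₀ y + ⟪τ i, gu y⟫ = ⟪b i, gu y⟫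
      conv_rhs => rw [hbτ i]
      rw [inner_add_left, real_inner_smul_left, smul_eq_mul]
    · show c i • g₀' y + ⟪n, gτ i y⟫ = c i * g₀' y + ⟪n, gτ i y⟫
      rw [smul_eq_mul]
  set gn : H → H := fun y => ∑ i, (c i * g₀' y + ⟪n, gτ i y⟫) • b i with hgn
  have hgnw : HasWeakDerivAlong U' μ (fun _ => n) gu gn := by
    have hterm : ∀ i, HasWeakDerivAlong U' μ (fun _ => n) (fun y => ⟪b i, gu y⟫ • b i)
        (fun y => (c i * g₀' y + ⟪n, gτ i y⟫) • b i) := fun i => by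
      have := (hbn i).clm_apply (hX1 _) (ContinuousLinearMap.toSpanSingleton ℝ (b i))
      simpa only [ContinuousLinearMap.toSpanSingleton_apply] using this
    have hsum := HasWeakDerivAlong.finset_sum (hX1 _) Finset.univ (fun i _ => hterm i)
    exact hsum.congr (Eventually.of_forall fun y => b.sum_repr' (gu y))
  have hgnk : MemSobolevDomain k 2 U' μ gn := by
    refine memSobolevDomain_finsetSum _ fun i _ => ?_
    have hsc : MemSobolevDomain k 2 U' μ (fun y => c i * g₀' y + ⟪n, gτ i y⟫) :=
      (hg₀'k.const_mul' (c i)).add' ((hgτk i).const_inner n)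
    exact hsc.smul_const (b i)
  -- STEP 9: directional derivatives along the basis and the weak Fréchet derivative
  have hGf : ∀ i, HasWeakDerivAlong U' μ (fun _ => b i) gu (fun y => c i • gn y + gτ i y) := fun i => by
    have h1 := hgnw.smul_field (hX1 _) (ψ := fun _ => c i) contDiff_const
    have h2 := h1.add_field contDiff_const (hX1 _) (hgτ i)
    have e : (fun x : H => (fun _ : H => c i) x • (fun _ : H => n) x + (fun _ : H => τ i) x) =
        fun _ => b i := funext fun _ => (hbτ i).symm
    rw [e] at h2
    exact h2
  have hGfk : ∀ i, MemSobolevDomain k 2 U' μ (fun y => c i • gn y + gτ i y) := fun i =>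
    memSobolevDomain_add (hgnk.const_smul (c i)) (hgτk i)
  refine ⟨_, HasWeakDerivAlong.hasWeakFDerivOn_of_basis b hGf i₀, fun v => ?_⟩
  have e : (fun y => (∑ i, (innerSL ℝ (b i)).smulRight (c i • gn y + gτ i y)) v) =
      fun y => ∑ i, ⟪b i, v⟫ • (c i • gn y + gτ i y) := by
    funext y
    rw [FunLike.coe_sum, Finset.sum_apply]
    refine Finset.sum_congr rfl fun i _ => ?_
    rw [ContinuousLinearMap.smulRight_apply, innerSL_apply_apply]
  rw [e]
  exact memSobolevDomain_finsetSum _ fun i _ => (hGfk i).const_smul _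

/-- **Normal regularity: the weak gradient is in `W^{1,2}` near the flat boundary**
(Evans, *PDE*, §6.3.2, Theorem 4 with §6.3.1, Theorem 1, step 4; Taylor, *PDE I*, Ch. 5 §7,
Prop. 7.2): for smooth, globally uniformly elliptic coefficients, `ν ≠ 0` and `0 < r < R`, the weak
gradient `∇u` of a weak solution of the Neumann problem on `U_R` has a weak Fréchet derivative on
`U_r` with `L²` components (the case `m = 0` of `exists_hasWeakFDerivOn_grad_of_tangential`, the
tangential derivatives being supplied by `exists_hasWeakDerivAlong_tangential`).
[cite: Evans2010, §6.3.2 Theorem 4] -/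
theorem exists_hasWeakFDerivOn_grad [μ.IsAddHaarMeasure]
    (hsol : IsWeakNeumannHalfBall μ ν z R A F G u gu) (hA : ContDiff ℝ ∞ A) {lam : ℝ}
    (hlam : 0 < lam) (hell : ∀ (y : H) (ξ : H), lam * ‖ξ‖ ^ 2 ≤ ⟪A y ξ, ξ⟫) (hν : ν ≠ 0) {r : ℝ}
    (hr : 0 < r) (hrR : r < R) :
    ∃ Dgu : H → H →L[ℝ] H, HasWeakFDerivOn (halfBall ν z r) μ gu Dgu ∧
      ∀ v : H, MemLp (fun y => Dgu y v) 2 (μ.restrict (halfBall ν z r : Set H)) := by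
  have hU'U : halfBall ν z r ≤ halfBall ν z R := halfBall_mono hrR.le
  have hA1 : ContDiff ℝ 1 A := hA.of_le (by norm_cast)
  have hellR : ∀ y ∈ ball z R, ∀ ξ : H, lam * ‖ξ‖ ^ 2 ≤ ⟪A y ξ, ξ⟫ := fun y _ ξ => hell y ξ
  have htan : ∀ τ : H, ⟪τ, ν⟫ = 0 → ∃ gτ : H → H, MemSobolevDomain 0 2 (halfBall ν z r) μ gτ ∧
      HasWeakDerivAlong (halfBall ν z r) μ (fun _ => τ) gu gτ := fun τ hτ => by
    obtain ⟨gτ, hm, hd⟩ := hsol.exists_hasWeakDerivAlong_tangential hA1 hlam hellR hr hrR hτ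
    exact ⟨gτ, (memSobolevDomain_zero_iff).2 hm, hd⟩
  have hgum : MemSobolevDomain 0 2 (halfBall ν z r) μ gu := (memSobolevDomain_zero_iff).2
    (hsol.memLp_grad.mono_measure (Measure.restrict_mono_set μ hU'U))
  have hFm : MemSobolevDomain 0 2 (halfBall ν z r) μ F := (memSobolevDomain_zero_iff).2
    (hsol.memLp_source.mono_measure (Measure.restrict_mono_set μ hU'U))
  obtain ⟨-, DG, hDG, hDGk⟩ := hsol.memSobolev_flux
  have hDGex : ∃ DG : H → H →L[ℝ] H, HasWeakFDerivOn (halfBall ν z R) μ G DG ∧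
      ∀ v : H, MemSobolevDomain 0 2 (halfBall ν z r) μ (fun y => DG y v) :=
    ⟨DG, hDG, fun v => MemSobolevDomain.mono_set_holds (hDGk v) hU'U⟩
  obtain ⟨Dgu, hD, hDk⟩ := hsol.exists_hasWeakFDerivOn_grad_of_tangential hA hlam hell hν hrR.le
    htan hgum hFm hDGex
  exact ⟨Dgu, hD, fun v => (memSobolevDomain_zero_iff).1 (hDk v)⟩

/-- **`∇u ∈ W^{1,2}(U_r; H)`** for weak solutions of the Neumann problem near the flat boundary
(Evans, *PDE*, §6.3.2, Theorem 4). [cite: Evans2010, §6.3.2 Theorem 4] -/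
theorem memSobolevDomain_grad [μ.IsAddHaarMeasure]
    (hsol : IsWeakNeumannHalfBall μ ν z R A F G u gu) (hA : ContDiff ℝ ∞ A) {lam : ℝ}
    (hlam : 0 < lam) (hell : ∀ (y : H) (ξ : H), lam * ‖ξ‖ ^ 2 ≤ ⟪A y ξ, ξ⟫) (hν : ν ≠ 0) {r : ℝ}
    (hr : 0 < r) (hrR : r < R) : MemSobolevDomain 1 2 (halfBall ν z r) μ gu := by
  obtain ⟨Dgu, hD, hDm⟩ := hsol.exists_hasWeakFDerivOn_grad hA hlam hell hν hr hrR
  exact ⟨hsol.memLp_grad.mono_measure (Measure.restrict_mono_set μ (halfBall_mono hrR.le)), Dgu, hD,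
    fun v => (memSobolevDomain_zero_iff).2 (hDm v)⟩

/-- **Boundary `H²`-regularity for the Neumann problem** (Evans, *PDE*, §6.3.2, Theorem 4, in the
Neumann setting of Taylor, *PDE I*, Ch. 5 §7, Prop. 7.2): a weak solution of the Neumann problem on
the half-ball `U_R` with smooth, uniformly elliptic coefficients, `F ∈ L²`, `G ∈ W^{1,2}`, lies in
`W^{2,2}(U_r)` for every `0 < r < R`. [cite: Evans2010, §6.3.2 Theorem 4] -/
theorem memSobolevDomain_two [μ.IsAddHaarMeasure]
    (hsol : IsWeakNeumannHalfBall μ ν z R A F G u gu) (hA : ContDiff ℝ ∞ A) {lam : ℝ}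
    (hlam : 0 < lam) (hell : ∀ (y : H) (ξ : H), lam * ‖ξ‖ ^ 2 ≤ ⟪A y ξ, ξ⟫) (hν : ν ≠ 0) {r : ℝ}
    (hr : 0 < r) (hrR : r < R) : MemSobolevDomain 2 2 (halfBall ν z r) μ u := by
  obtain ⟨Dgu, hD, hDm⟩ := hsol.exists_hasWeakFDerivOn_grad hA hlam hell hν hr hrR
  have hU'U : halfBall ν z r ≤ halfBall ν z R := halfBall_mono hrR.le
  have hguU' : MemLp gu 2 (μ.restrict (halfBall ν z r : Set H)) :=
    hsol.memLp_grad.mono_measure (Measure.restrict_mono_set μ hU'U)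
  set b := stdOrthonormalBasis ℝ H with hb
  obtain ⟨i₀⟩ : Nonempty (Fin (Module.finrank ℝ H)) :=
    ⟨⟨0, Module.finrank_pos_iff_exists_ne_zero.2 ⟨ν, hν⟩⟩⟩
  refine ⟨hsol.memLp.mono_measure (Measure.restrict_mono_set μ hU'U), _,
    HasWeakFDerivOn.mono_set_holds hsol.hasWeakFDerivOn hU'U, fun v => ?_⟩
  -- the scalar component `⟪∇u, v⟫` and its directional derivatives along the basis
  have hdir : ∀ i, HasWeakDerivAlong (halfBall ν z r) μ (fun _ => b i) (fun y => innerSL ℝ (gu y) v)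
      (fun y => ⟪v, Dgu y (b i)⟫) := fun i => by
    have h := ((hD.hasWeakDerivAlong contDiff_const (X := fun _ => b i)).clm_apply contDiff_const
      (innerSL ℝ v))
    refine h.congr (Eventually.of_forall fun y => ?_)
    show innerSL ℝ v (gu y) = innerSL ℝ (gu y) v
    rw [innerSL_apply_apply, innerSL_apply_apply, real_inner_comm]
  have hW := HasWeakDerivAlong.hasWeakFDerivOn_of_basis b hdir i₀
  refine ⟨?_, _, hW, fun w => ?_⟩
  · simpa only [innerSL_apply_apply] using memLp_inner_const hguU' v
  · rw [memSobolevDomain_zero_iff]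
    have e : (fun y => (∑ i, (innerSL ℝ (b i)).smulRight ⟪v, Dgu y (b i)⟫) w) =
        fun y => ∑ i, ⟪b i, w⟫ * ⟪v, Dgu y (b i)⟫ := by
      funext y
      rw [FunLike.coe_sum, Finset.sum_apply]
      refine Finset.sum_congr rfl fun i _ => ?_
      rw [ContinuousLinearMap.smulRight_apply, innerSL_apply_apply, smul_eq_mul]
    rw [e]
    exact memLp_finsetSum _ fun i _ => (memLp_const_inner (hDm (b i)) v).const_mul _

end IsWeakNeumannHalfBall

end Literature.Analysis.PDE

end
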